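import Mathlib.Analysis.Calculus.ContDiff.Bounds
import Mathlib.Algebra.BigOperators.Field
import Mathlib.Analysis.Calculus.IteratedDeriv.Defs
import HarnessLib

/-!
# K1loc, line `Spectral` / SeqCone — helper: SCALE-`b` DERIVATIVE BOUNDS ARE CLOSED UNDER PRODUCTS (S-B Taylor data)

Helper file of the prover lane on the crux `K1LocalisedCascade` (stmt-AnomalousDissipation-19491), route
`SawtoothPulseCascade` (memo v6 addendum §C).  The fibre symbols of the assembly are products of smooth-step profiles with
all-orders bounds `|f⁽ⁱ⁾| ≤ C_i/bⁱ` at a common scale `b` (`…SmoothStepData`); the mid-phase symbol `g^M` and the complements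
`1 − ψ·φ` are products of such profiles.  The Leibniz rule (Mathlib `norm_iteratedFDeriv_mul_le`) shows the class is closed under
products with constants `Σ_i C(n,i) C^f_i C^g_{n−i}`: `abs_iteratedDeriv_mul_le_of_scale`.  No definitions; no statement about
the stub.  [cite: Grafakos2014, Prop. 3.1.2 (5)] [problem: turb]
-/

-- `Summit.<Summit>.<Problem>`: single-conjunct summit, the duplicate namespace segment is deliberate.
set_option linter.dupNamespace false

noncomputable section

namespace Summit.AnomalousDissipation.AnomalousDissipation.Theorems.SawtoothPulseCascade.K1Cutoff

open Set
open scoped ContDiff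

/-- **Leibniz at scale `b`.**  If `f, g : ℝ → ℝ` are smooth with `|f⁽ⁱ⁾| ≤ C^f_i/bⁱ` and `|g⁽ⁱ⁾| ≤ C^g_i/bⁱ` for `i ≤ n`
(`b > 0`), then `|(fg)⁽ⁿ⁾| ≤ (Σ_{i≤n} C(n,i) C^f_i C^g_{n−i})/bⁿ`. [folklore] -/
theorem abs_iteratedDeriv_mul_le_of_scale {f g : ℝ → ℝ} (hf : ContDiff ℝ ∞ f) (hg : ContDiff ℝ ∞ g) {n : ℕ} {b : ℝ}
    (hb : 0 < b) {Cf Cg : ℕ → ℝ} (hCf : ∀ i ≤ n, ∀ x, |iteratedDeriv i f x| ≤ Cf i / b ^ i)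
    (hCg : ∀ i ≤ n, ∀ x, |iteratedDeriv i g x| ≤ Cg i / b ^ i) (x : ℝ) :
    |iteratedDeriv n (fun y => f y * g y) x| ≤ (∑ i ∈ Finset.range (n + 1), (n.choose i : ℝ) * Cf i * Cg (n - i)) / b ^ n := by
  have h := norm_iteratedFDeriv_mul_le (𝕜 := ℝ) hf hg x (n := n) (by exact_mod_cast le_top)
  simp only [norm_iteratedFDeriv_eq_norm_iteratedDeriv, Real.norm_eq_abs] at h
  refine h.trans ?_
  rw [Finset.sum_div]
  refine Finset.sum_le_sum fun i hi => ?_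
  have hin : i ≤ n := Nat.lt_succ_iff.mp (Finset.mem_range.mp hi)
  have h1 := hCf i hin x
  have h2 := hCg (n - i) (Nat.sub_le n i) x
  have hC0 : 0 ≤ Cf i := by
    have := (abs_nonneg _).trans h1
    rwa [le_div_iff₀ (pow_pos hb i), zero_mul] at this
  have hpow : b ^ i * b ^ (n - i) = b ^ n := by rw [← pow_add, Nat.add_sub_cancel' hin]
  calc (n.choose i : ℝ) * |iteratedDeriv i f x| * |iteratedDeriv (n - i) g x|
      ≤ (n.choose i : ℝ) * (Cf i / b ^ i) * (Cg (n - i) / b ^ (n - i)) := by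
        apply mul_le_mul (mul_le_mul_of_nonneg_left h1 (by positivity)) h2 (abs_nonneg _)
        exact mul_nonneg (by positivity) (div_nonneg hC0 (pow_nonneg hb.le _))
    _ = (n.choose i : ℝ) * Cf i * Cg (n - i) / b ^ n := by
        rw [← hpow]; field_simp

end Summit.AnomalousDissipation.AnomalousDissipation.Theorems.SawtoothPulseCascade.K1Cutoff
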